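import Literature.NumberTheory.EllipticCurves.FormalGroupMultiplication
import Literature.NumberTheory.EllipticCurves.FormalGroupLawAxiomsProofs
import HarnessLib

/-!
# `[n]` is an endomorphism of the formal group: `[n](F(z₁, z₂)) = F([n]z₁, [n]z₂)` (Silverman AEC IV.2.3; proofs only)

Trunk `Literature/NumberTheory/EllipticCurves`; sequel of `FormalGroupMultiplication` (`[m+n] = F([m],[n])`,
`[m]∘[n] = [mn]`) and `FormalGroupLawAxiomsProofs` (the group axioms of the chord–tangent law `F` over `ℚ_p` by
the identity theorem for integral power series). Silverman AEC IV.2.3: "the maps `[m] : 𝓕 → 𝓕` are homomorphisms";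
here, for a `p`-integral equation `V` over `ℚ_p`,

* `formalMul_subst_formalGroupLaw : [n](F(z₁, z₂)) = F([n](z₁), [n](z₂))` in `ℚ_p⟦z₁, z₂⟧`,

by the two-variable identity theorem (`eq_of_padicEvalMv_eq`): at a point `(z(P), z(Q))` of the open bidisc both sides
evaluate to `z(n(P + Q)) = z(nP + nQ)` (`padicEval_formalMul_formalParameter`,
`padicEval₂_formalGroupLaw_eq_formalParameter_add`). This is the input of the additivity of Fontaine's element
`[t ⊕ t'] = [t] ⊕ [t']` of Tate-module points of `Ê` in `𝔸_inf` (`PAdicHodge/AinfWeierstrassTorsionLift`). No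
definitions, no named facts, no `sorry`.

## References
* J. H. Silverman, *The Arithmetic of Elliptic Curves*, 2nd ed. (2009), IV.2.3. [SilvermanAEC2009]
-/

noncomputable section

open scoped Classical
open PowerSeries Literature.NumberTheory.EllipticCurves

namespace WeierstrassCurve

variable {p : ℕ} [Fact p.Prime] (V : WeierstrassCurve ℚ_[p]) [hV : V.IsIntegral ℤ_[p]]

omit hV in
/-- `[n](zᵢ)` read in two variables has no constant term. [folklore] -/
private theorem constantCoeff_formalMul_subst_X_fin (n : ℕ) (i : Fin 2) :
    MvPowerSeries.constantCoeff ((V.formalMul n).subst (MvPowerSeries.X i : MvPowerSeries (Fin 2) ℚ_[p])) = 0 :=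
  MvPowerSeries.constantCoeff_subst_eq_zero (PowerSeries.HasSubst.const (PowerSeries.HasSubst.X i))
    (fun _ => MvPowerSeries.constantCoeff_X i) (V.constantCoeff_formalMul n)

/-- **AEC IV.2.3: `[n]` is a homomorphism of the formal group** — `[n](F(z₁, z₂)) = F([n](z₁), [n](z₂))` in
`ℚ_p⟦z₁, z₂⟧` for a `p`-integral elliptic equation. [cite: SilvermanAEC2009, IV.2.3] -/
theorem formalMul_subst_formalGroupLaw (n : ℕ) :
    (V.formalMul n).subst V.formalGroupLaw =
      MvPowerSeries.subst ![(V.formalMul n).subst (MvPowerSeries.X 0 : MvPowerSeries (Fin 2) ℚ_[p]),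
        (V.formalMul n).subst (MvPowerSeries.X 1 : MvPowerSeries (Fin 2) ℚ_[p])] V.formalGroupLaw := by
  have hF := V.isPadicInt_formalGroupLaw
  have hn := V.isPadicInt_formalMul n
  -- integrality of both sides
  have hL : IsPadicInt ((V.formalMul n).subst V.formalGroupLaw) :=
    hn.powerSeries_subst hF (HasSubst.of_constantCoeff_zero V.constantCoeff_formalGroupLaw)
  have ha : ∀ i, IsPadicInt ((![(V.formalMul n).subst (MvPowerSeries.X 0 : MvPowerSeries (Fin 2) ℚ_[p]),
      (V.formalMul n).subst (MvPowerSeries.X 1 : MvPowerSeries (Fin 2) ℚ_[p])]) i) := fun i => by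
    fin_cases i <;> exact hn.powerSeries_subst (IsPadicInt.X _) (PowerSeries.HasSubst.X _)
  have ha0 : ∀ i, MvPowerSeries.constantCoeff ((![(V.formalMul n).subst (MvPowerSeries.X 0 : MvPowerSeries (Fin 2) ℚ_[p]),
      (V.formalMul n).subst (MvPowerSeries.X 1 : MvPowerSeries (Fin 2) ℚ_[p])]) i) = 0 := fun i => by
    fin_cases i
    · exact constantCoeff_formalMul_subst_X_fin V n 0
    · exact constantCoeff_formalMul_subst_X_fin V n 1
  have hR : IsPadicInt (MvPowerSeries.subst ![(V.formalMul n).subst (MvPowerSeries.X 0 : MvPowerSeries (Fin 2) ℚ_[p]),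
      (V.formalMul n).subst (MvPowerSeries.X 1 : MvPowerSeries (Fin 2) ℚ_[p])] V.formalGroupLaw) :=
    hF.subst ha (MvPowerSeries.hasSubst_of_constantCoeff_zero ha0)
  refine eq_of_padicEvalMv_eq hL hR fun pt hpt => ?_
  -- points of the bidisc are formal parameters of points of `E₁(ℚ_p)`
  obtain ⟨P, hP, hP'⟩ := V.exists_isInReductionKernel_formalParameter_eq_of_isIntegral (hpt 0)
  obtain ⟨Q, hQ, hQ'⟩ := V.exists_isInReductionKernel_formalParameter_eq_of_isIntegral (hpt 1)
  have hpt' : pt = ![V.formalParameter P, V.formalParameter Q] := by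
    funext i; fin_cases i
    · exact hP'.symm
    · exact hQ'.symm
  -- left side: `[n](z(P+Q)) = z(n(P+Q))`
  rw [padicEvalMv_powerSeries_subst hn hF V.constantCoeff_formalGroupLaw hpt,
    padicEvalMv_subst hF ha ha0 hpt]
  have h1 : (fun i => padicEvalMv ((![(V.formalMul n).subst (MvPowerSeries.X 0 : MvPowerSeries (Fin 2) ℚ_[p]),
      (V.formalMul n).subst (MvPowerSeries.X 1 : MvPowerSeries (Fin 2) ℚ_[p])]) i) pt) =
      ![V.formalParameter (n • P), V.formalParameter (n • Q)] := by
    funext i; fin_cases i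
    · show padicEvalMv ((V.formalMul n).subst (MvPowerSeries.X 0 : MvPowerSeries (Fin 2) ℚ_[p])) pt = _
      rw [padicEvalMv_subst_X hn hpt 0, hpt']
      exact V.padicEval_formalMul_formalParameter n hP
    · show padicEvalMv ((V.formalMul n).subst (MvPowerSeries.X 1 : MvPowerSeries (Fin 2) ℚ_[p])) pt = _
      rw [padicEvalMv_subst_X hn hpt 1, hpt']
      exact V.padicEval_formalMul_formalParameter n hQ
  rw [h1, hpt', ← padicEval₂_eq_padicEvalMv, ← padicEval₂_eq_padicEvalMv,
    V.padicEval₂_formalGroupLaw_eq_formalParameter_add hP hQ, V.padicEval_formalMul_formalParameter n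
      (V.isInReductionKernel_add hP hQ),
    V.padicEval₂_formalGroupLaw_eq_formalParameter_add (V.isInReductionKernel_nsmul hP n)
      (V.isInReductionKernel_nsmul hQ n), nsmul_add]

end WeierstrassCurve

end
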